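import Literature.Geometry.Lorentzian.KerrObstructionOuterLayer
import HarnessLib

/-!
# Continuity of the four-parameter Kerr cylinder family in `p = (δm, b⃗)`

Support file (all results proved; no named facts) for the named fact `LiMei.interiorKerrGluing`
(`InteriorKerrGluing.lean`; J. Li, H. Mei, *A construction of collapsing spacetimes in vacuum*,
Comm. Math. Phys. 378 (2020) = arXiv:2005.01249, Prop. 4.1). The degree step of the reduction
`LiMei.interiorKerrGluing_of_core` needs the obstruction `𝓘(p)` to be CONTINUOUS on a closed ball
of parameters `p = (δm, b⃗) ∈ ℝ × E3`; every piece of it is built from the Kerr cylinder family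
`p ↦ (H, K)[M + δm, ‖b⃗‖, R_{b⃗}]` (`R_{b⃗} = spinIsometry b⃗`), whose frame `R_{b⃗}` is NOT
continuous in `b⃗` (it depends on the direction `b⃗/‖b⃗‖`). This file proves that the FIELDS are
nevertheless continuous in `p` at every point of the admissible parameter box:

* off `b⃗ = 0`, by the two smooth charts of rotations of `KerrCylinderAxialSymmetry.lean`
  (`contDiffOn_spinIsometry` off the upward ray, `contDiffOn_spinIsometry₂` off the downward ray,
  same data by canonicity `kerrCylinderDatum_h_inner/k_spinIsometry₂`), the isometry covariance
  `cylH₀_isometry` / `cylK₀_isometry` and the joint smoothness `contDiffOn_cylH₀₃` /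
  `contDiffOn_cylK₀₃` in `(m, a, y)`;
* at `b⃗ = 0`, by the uniform first-order expansion of the family
  (`exists_abs_cylH_family_le`, `exists_abs_cylK_family_le`) around `(M + δm₀, 0)`.

Main results: `LiMei.continuousAt_cylH_family`, `LiMei.continuousAt_cylK_family` (pointwise in
`y` on the shell `{ρ₁ < ‖y‖ < ρ₂}`, `ρ₁ ≥ 1`, all `v, w`), and, by dominated convergence, the
continuity in `p` of the outer-layer linearised obstruction functionals of
`KerrObstructionOuterLayer.lean`: `LiMei.exists_continuousOn_integral_timeIntegrandWith_family`,
`LiMei.exists_continuousOn_integral_rotIntegrandWith_family` (with the pointwise bounds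
`LiMei.abs_timeIntegrandWith_family_le`, `LiMei.abs_rotIntegrandWith_family_le`).

## References

* J. Li, H. Mei, arXiv:2005.01249, §4, proof of Prop. 4.1, p. 25 (key `LiMei2020`).
-/

noncomputable section

open Set Filter Function Metric MeasureTheory
open scoped Topology RealInnerProductSpace Real

namespace Literature.Geometry.Lorentzian

namespace LiMei

attribute [local instance] instNormedAddCommGroupBilinE3 instNormedSpaceBilinE3

section Charts

variable {M r₀ : ℝ}

/-! ### Continuity through a continuous chart of frames -/

/-- **Continuity of the metric field through a continuous chart of frames**: if `b ↦ S b` is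
continuous at `p₀.2` as a map into continuous linear maps, then
`p ↦ H[M + p.1, ‖p.2‖, S p.2](y)(v, w)` is continuous at `p₀` (`y ≠ 0`, `0 < r₀`). [folklore] -/
theorem continuousAt_cylH_chart (hr₀ : 0 < r₀) (τ₀ : ℝ) {S : E3 → (E3 →ₗᵢ[ℝ] E3)} {p₀ : ℝ × E3}
    (hS : ContinuousAt (fun b ↦ (S b).toContinuousLinearMap) p₀.2) {y : E3} (hy : y ≠ 0)
    (v w : E3) :
    ContinuousAt (fun p : ℝ × E3 ↦ cylH (M + p.1) ‖p.2‖ r₀ τ₀ (S p.2) y v w) p₀ := by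
  have hform : (fun p : ℝ × E3 ↦ cylH (M + p.1) ‖p.2‖ r₀ τ₀ (S p.2) y v w) = fun p ↦
      cylCutoff y * cylH₀ (M + p.1) ‖p.2‖ r₀ τ₀ LinearIsometry.id (S p.2 y) (S p.2 v) (S p.2 w) +
        (1 - cylCutoff y) * ⟪v, w⟫ := by
    funext p; rw [cylH_apply, cylH₀_isometry]
  rw [hform]
  have hSu : ∀ u : E3, ContinuousAt (fun p : ℝ × E3 ↦ S p.2 u) p₀ := fun u ↦
    (hS.comp continuousAt_snd).clm_apply continuousAt_const
  have hq : ContinuousAt (fun p : ℝ × E3 ↦ ((M + p.1, ‖p.2‖, S p.2 y) : ℝ × ℝ × E3)) p₀ :=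
    (continuousAt_const.add continuousAt_fst).prodMk
      ((continuous_norm.continuousAt.comp continuousAt_snd).prodMk (hSu y))
  have hne : ((M + p₀.1, ‖p₀.2‖, S p₀.2 y) : ℝ × ℝ × E3) ∈ {q : ℝ × ℝ × E3 | q.2.2 ≠ 0} :=
    isometry_apply_ne_zero (S p₀.2) hy
  have hO : IsOpen {q : ℝ × ℝ × E3 | q.2.2 ≠ 0} :=
    isOpen_ne.preimage (continuous_snd.comp continuous_snd)
  have hT : ContinuousAt
      (fun p : ℝ × E3 ↦ cylH₀ (M + p.1) ‖p.2‖ r₀ τ₀ LinearIsometry.id (S p.2 y)) p₀ :=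
    ContinuousAt.comp (g := fun q : ℝ × ℝ × E3 ↦ cylH₀ q.1 q.2.1 r₀ τ₀ LinearIsometry.id q.2.2)
      (f := fun p : ℝ × E3 ↦ ((M + p.1, ‖p.2‖, S p.2 y) : ℝ × ℝ × E3))
      ((contDiffOn_cylH₀₃ hr₀ τ₀ LinearIsometry.id).continuousOn.continuousAt (hO.mem_nhds hne)) hq
  exact ((continuousAt_const.mul ((hT.clm_apply (hSu v)).clm_apply (hSu w))).add
    continuousAt_const)

/-- **Continuity of the second fundamental form field through a continuous chart of frames**, at
points of the interior parameter region `Δ_{M + p₀.1, ‖p₀.2‖}(r₀) < 0`. [folklore] -/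
theorem continuousAt_cylK_chart [Kerr.Facts] (hr₀ : 0 < r₀) (τ₀ : ℝ) {S : E3 → (E3 →ₗᵢ[ℝ] E3)} {p₀ : ℝ × E3}
    (hS : ContinuousAt (fun b ↦ (S b).toContinuousLinearMap) p₀.2)
    (hΔ : r₀ ^ 2 - 2 * (M + p₀.1) * r₀ + ‖p₀.2‖ ^ 2 < 0) {y : E3} (hy : y ≠ 0) (v w : E3) :
    ContinuousAt (fun p : ℝ × E3 ↦ cylK (M + p.1) ‖p.2‖ hr₀ τ₀ (S p.2) y v w) p₀ := by
  -- `Δ < 0` on a neighbourhood of `p₀`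
  have hΔn : ∀ᶠ p : ℝ × E3 in 𝓝 p₀, r₀ ^ 2 - 2 * (M + p.1) * r₀ + ‖p.2‖ ^ 2 < 0 := by
    have hc : Continuous fun p : ℝ × E3 ↦ r₀ ^ 2 - 2 * (M + p.1) * r₀ + ‖p.2‖ ^ 2 := by fun_prop
    exact (isOpen_lt hc continuous_const).mem_nhds hΔ
  have hform : (fun p : ℝ × E3 ↦ cylK (M + p.1) ‖p.2‖ hr₀ τ₀ (S p.2) y v w) =ᶠ[𝓝 p₀] fun p ↦
      cylCutoff y * cylK₀ (M + p.1) ‖p.2‖ hr₀ τ₀ LinearIsometry.id (S p.2 y) (S p.2 v) (S p.2 w) := by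
    filter_upwards [hΔn] with p hp
    rw [cylK_apply, cylK₀_isometry hr₀ hp τ₀ (S p.2) hy]
  refine (ContinuousAt.congr ?_ hform.symm)
  have hSu : ∀ u : E3, ContinuousAt (fun p : ℝ × E3 ↦ S p.2 u) p₀ := fun u ↦
    (hS.comp continuousAt_snd).clm_apply continuousAt_const
  have hq : ContinuousAt (fun p : ℝ × E3 ↦ ((M + p.1, ‖p.2‖, S p.2 y) : ℝ × ℝ × E3)) p₀ :=
    (continuousAt_const.add continuousAt_fst).prodMk
      ((continuous_norm.continuousAt.comp continuousAt_snd).prodMk (hSu y))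
  have hne : ((M + p₀.1, ‖p₀.2‖, S p₀.2 y) : ℝ × ℝ × E3) ∈
      {q : ℝ × ℝ × E3 | q.2.2 ≠ 0 ∧ r₀ ^ 2 - 2 * q.1 * r₀ + q.2.1 ^ 2 < 0} :=
    ⟨isometry_apply_ne_zero (S p₀.2) hy, hΔ⟩
  have hO : IsOpen {q : ℝ × ℝ × E3 | q.2.2 ≠ 0 ∧ r₀ ^ 2 - 2 * q.1 * r₀ + q.2.1 ^ 2 < 0} :=
    (isOpen_ne.preimage (continuous_snd.comp continuous_snd)).inter
      ((isOpen_delta_neg r₀).preimage (continuous_fst.prodMk (continuous_fst.comp continuous_snd)))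
  have hT : ContinuousAt
      (fun p : ℝ × E3 ↦ cylK₀ (M + p.1) ‖p.2‖ hr₀ τ₀ LinearIsometry.id (S p.2 y)) p₀ :=
    ContinuousAt.comp (g := fun q : ℝ × ℝ × E3 ↦ cylK₀ q.1 q.2.1 hr₀ τ₀ LinearIsometry.id q.2.2)
      (f := fun p : ℝ × E3 ↦ ((M + p.1, ‖p.2‖, S p.2 y) : ℝ × ℝ × E3))
      ((contDiffOn_cylK₀₃ hr₀ τ₀ LinearIsometry.id).continuousOn.continuousAt (hO.mem_nhds hne)) hq
  exact continuousAt_const.mul ((hT.clm_apply (hSu v)).clm_apply (hSu w))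

/-! ### The two charts of rotations -/

/-- The first chart `spinIsometry` is continuous off `0` and the upward ray. [folklore] -/
theorem continuousAt_spinIsometry {b : E3} (hb : b ≠ 0) (hax : ‖b‖⁻¹ • b ≠ axisVec) :
    ContinuousAt (fun b : E3 ↦ (spinIsometry b).toContinuousLinearMap) b := by
  have hO : IsOpen {b : E3 | b ≠ 0 ∧ ‖b‖⁻¹ • b ≠ axisVec} := by
    have h := isOpen_spinIsometry_good
    convert h using 1
    ext b; simp [not_or]
  exact contDiffOn_spinIsometry.continuousOn.continuousAt (hO.mem_nhds ⟨hb, hax⟩)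

/-- The second chart `spinIsometry₂` is continuous off `0` and the downward ray. [folklore] -/
theorem continuousAt_spinIsometry₂ {b : E3} (hb : b ≠ 0) (hax : ‖b‖⁻¹ • b ≠ -axisVec) :
    ContinuousAt (fun b : E3 ↦ (spinIsometry₂ b).toContinuousLinearMap) b := by
  have hO : IsOpen {b : E3 | b ≠ 0 ∧ ‖b‖⁻¹ • b ≠ -axisVec} := by
    have hc : ContinuousOn (fun b : E3 ↦ ‖b‖⁻¹ • b) {b : E3 | b ≠ 0} :=
      ((continuousOn_id.norm).inv₀ fun b hb ↦ norm_ne_zero_iff.2 hb).smul continuousOn_id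
    exact hc.isOpen_inter_preimage isOpen_ne (isOpen_ne (x := -axisVec))
  exact contDiffOn_spinIsometry₂.continuousOn.continuousAt (hO.mem_nhds ⟨hb, hax⟩)

/-- A unit vector is not both `e₃` and `−e₃`. [folklore] -/
theorem ne_neg_axisVec_of_eq {u : E3} (h : u = axisVec) : u ≠ -axisVec := by
  rw [h]
  intro h'
  have h2 : (axisVec : E3) 2 = (-axisVec : E3) 2 := by rw [← h']
  norm_num [axisVec] at h2

/-- **The chart switch for the metric field**: near a nonzero `b` with admissible parameters the
family through `spinIsometry₂` coincides with the family through `spinIsometry` (canonicity of the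
Kerr cylinder datum). [cite: LiMei2020, proof of Prop. 4.1, p. 22] -/
theorem cylH_spinIsometry₂_eq [Kerr.Facts] {m r₀ : ℝ} {b : E3} (hb : b ≠ 0) (ha : |‖b‖| < m)
    (h₁ : Kerr.rMinus m ‖b‖ < r₀) (h₂ : r₀ < Kerr.rPlus m ‖b‖) (τ₀ : ℝ) (y : E3) :
    cylH m ‖b‖ r₀ τ₀ (spinIsometry₂ b) y = cylH m ‖b‖ r₀ τ₀ (spinIsometry b) y :=
  kerrCylinderDatum_h_inner_spinIsometry₂ hb ha h₁ h₂ τ₀ y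

/-- **The chart switch for the second fundamental form field.** [cite: LiMei2020, proof of Prop. 4.1, p. 22] -/
theorem cylK_spinIsometry₂_eq [Kerr.Facts] {m r₀ : ℝ} {b : E3} (hb : b ≠ 0) (ha : |‖b‖| < m)
    (h₁ : Kerr.rMinus m ‖b‖ < r₀) (h₂ : r₀ < Kerr.rPlus m ‖b‖) (τ₀ : ℝ) (y : E3) :
    cylK m ‖b‖ (pos_of_rMinus_lt ha h₁) τ₀ (spinIsometry₂ b) y =
      cylK m ‖b‖ (pos_of_rMinus_lt ha h₁) τ₀ (spinIsometry b) y :=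
  kerrCylinderDatum_k_spinIsometry₂ hb ha h₁ h₂ τ₀ y

/-! ### Continuity at zero spin from the family expansion -/

/-- Bilinear evaluation at arbitrary vectors from unit vectors. [folklore] -/
theorem apply_eq_norm_mul_norm_mul (β : E3 →L[ℝ] E3 →L[ℝ] ℝ) (v w : E3) :
    β v w = ‖v‖ * ‖w‖ * β (‖v‖⁻¹ • v) (‖w‖⁻¹ • w) := by
  rcases eq_or_ne v 0 with rfl | hv
  · simp
  rcases eq_or_ne w 0 with rfl | hw
  · simp
  have hv' : ‖v‖ ≠ 0 := norm_ne_zero_iff.2 hv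
  have hw' : ‖w‖ ≠ 0 := norm_ne_zero_iff.2 hw
  simp only [map_smul, smul_apply, smul_eq_mul]
  field_simp

/-- `|b·(y × v)| ≤ ‖b‖ ‖y‖` for `‖v‖ ≤ 1`. [folklore] -/
theorem abs_triple_le {b y v : E3} (hv : ‖v‖ ≤ 1) : |triple b y v| ≤ ‖b‖ * ‖y‖ := by
  rw [← inner_crossVec_left]
  calc |⟪crossVec b y, v⟫| ≤ ‖crossVec b y‖ * ‖v‖ := abs_real_inner_le_norm _ _
    _ ≤ ‖b‖ * ‖y‖ * 1 := mul_le_mul (norm_crossVec_le b y) hv (norm_nonneg _) (by positivity)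
    _ = ‖b‖ * ‖y‖ := mul_one _

/-- `|⟪y, v⟫| ≤ ‖y‖` for `‖v‖ ≤ 1`. [folklore] -/
theorem abs_inner_le_norm_of_unit {y v : E3} (hv : ‖v‖ ≤ 1) : |⟪y, v⟫| ≤ ‖y‖ :=
  (abs_real_inner_le_norm _ _).trans (mul_le_of_le_one_right (norm_nonneg _) hv)

/-- **The first-order terms of the metric expansion are `O(|q|)` on unit vectors**:
`|q.1 (2/r₀)(⟨y,v⟩⟨y,w⟩/ρ²)| + |(2m/(r₀ρ³))(b·(y×v)⟨y,w⟩ + ⟨y,v⟩ b·(y×w))| ≤ (2/r₀ + 4|m|/r₀)(|q.1| + ‖b‖)`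
(`ρ ≥ 1`, `r₀ > 0`). [folklore] -/
theorem abs_firstOrder_terms_le (hr₀ : 0 < r₀) (m : ℝ) (q : ℝ × E3) {y v w : E3} (hy : 1 ≤ ‖y‖)
    (hv : ‖v‖ ≤ 1) (hw : ‖w‖ ≤ 1) :
    |q.1 * (2 / r₀ * (⟪y, v⟫ * ⟪y, w⟫ / ‖y‖ ^ 2))| +
        |2 * m / (r₀ * ‖y‖ ^ 3) * (triple q.2 y v * ⟪y, w⟫ + ⟪y, v⟫ * triple q.2 y w)| ≤
      (2 / r₀ + 4 * |m| / r₀) * (|q.1| + ‖q.2‖) := by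
  have hρ : 0 < ‖y‖ := lt_of_lt_of_le one_pos hy
  have hI : |⟪y, v⟫ * ⟪y, w⟫ / ‖y‖ ^ 2| ≤ 1 := by
    rw [abs_div, abs_mul, abs_of_pos (pow_pos hρ 2), div_le_one (pow_pos hρ 2), sq]
    exact mul_le_mul (abs_inner_le_norm_of_unit hv) (abs_inner_le_norm_of_unit hw) (abs_nonneg _)
      (norm_nonneg _)
  have h1 : |q.1 * (2 / r₀ * (⟪y, v⟫ * ⟪y, w⟫ / ‖y‖ ^ 2))| ≤ 2 / r₀ * |q.1| := by
    rw [abs_mul, abs_mul, abs_of_pos (by positivity : (0 : ℝ) < 2 / r₀)]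
    calc |q.1| * (2 / r₀ * |⟪y, v⟫ * ⟪y, w⟫ / ‖y‖ ^ 2|) ≤ |q.1| * (2 / r₀ * 1) := by gcongr
      _ = 2 / r₀ * |q.1| := by ring
  have hT : |triple q.2 y v * ⟪y, w⟫ + ⟪y, v⟫ * triple q.2 y w| ≤ 2 * ‖q.2‖ * ‖y‖ ^ 2 := by
    calc |triple q.2 y v * ⟪y, w⟫ + ⟪y, v⟫ * triple q.2 y w|
        ≤ |triple q.2 y v| * |⟪y, w⟫| + |⟪y, v⟫| * |triple q.2 y w| := by
          refine (abs_add_le _ _).trans ?_; rw [abs_mul, abs_mul]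
      _ ≤ ‖q.2‖ * ‖y‖ * ‖y‖ + ‖y‖ * (‖q.2‖ * ‖y‖) :=
          add_le_add (mul_le_mul (abs_triple_le hv) (abs_inner_le_norm_of_unit hw) (abs_nonneg _)
            (by positivity))
            (mul_le_mul (abs_inner_le_norm_of_unit hv) (abs_triple_le hw) (abs_nonneg _) (norm_nonneg _))
      _ = 2 * ‖q.2‖ * ‖y‖ ^ 2 := by ring
  have h2 : |2 * m / (r₀ * ‖y‖ ^ 3) * (triple q.2 y v * ⟪y, w⟫ + ⟪y, v⟫ * triple q.2 y w)| ≤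
      4 * |m| / r₀ * ‖q.2‖ := by
    rw [abs_mul, abs_div, abs_mul, abs_two, abs_of_pos (by positivity : (0 : ℝ) < r₀ * ‖y‖ ^ 3)]
    calc 2 * |m| / (r₀ * ‖y‖ ^ 3) * |triple q.2 y v * ⟪y, w⟫ + ⟪y, v⟫ * triple q.2 y w|
        ≤ 2 * |m| / (r₀ * ‖y‖ ^ 3) * (2 * ‖q.2‖ * ‖y‖ ^ 2) :=
          mul_le_mul_of_nonneg_left hT (by positivity)
      _ = 4 * |m| / r₀ * ‖q.2‖ / ‖y‖ := by field_simp; ring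
      _ ≤ 4 * |m| / r₀ * ‖q.2‖ := div_le_self (by positivity) hy
  calc _ ≤ 2 / r₀ * |q.1| + 4 * |m| / r₀ * ‖q.2‖ := add_le_add h1 h2
    _ ≤ (2 / r₀ + 4 * |m| / r₀) * (|q.1| + ‖q.2‖) := by
        have : 0 ≤ 2 / r₀ * ‖q.2‖ + 4 * |m| / r₀ * |q.1| := by positivity
        nlinarith

/-- **Continuity of the metric field of the family at zero spin, unit vectors**: for
`ρ₁ < ‖y‖ < ρ₂` (`ρ₁ ≥ 1`), `‖v‖, ‖w‖ ≤ 1` and `p₀ = (δm₀, 0)`,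
`|H[M + p.1, ‖p.2‖, R_{p.2}](y)(v,w) − ḡ_{M + δm₀}(y)(v,w)| ≤ A (|p.1 − δm₀| + ‖p.2‖)` whenever
`|p.1 − δm₀| + ‖p.2‖ ≤ 1`, from `exists_abs_cylH_family_le` around `M + δm₀`. [cite: LiMei2020, p. 25] -/
theorem exists_abs_cylH_family_sub_le_linear (M : ℝ) (hr₀ : 0 < r₀) (τ₀ : ℝ) {ρ₁ : ℝ}
    (hρ₁ : 1 ≤ ρ₁) (ρ₂ δm₀ : ℝ) :
    ∃ A : ℝ, 0 ≤ A ∧ ∀ p : ℝ × E3, |p.1 - δm₀| + ‖p.2‖ ≤ 1 → ∀ v w : E3, ‖v‖ ≤ 1 → ‖w‖ ≤ 1 →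
      ∀ y : E3, ρ₁ < ‖y‖ → ‖y‖ < ρ₂ →
        |cylH (M + p.1) ‖p.2‖ r₀ τ₀ (spinIsometry p.2) y v w - gbarRep (M + δm₀) r₀ y v w| ≤
          A * (|p.1 - δm₀| + ‖p.2‖) := by
  obtain ⟨C, hC0, hC⟩ := exists_abs_cylH_family_le (M + δm₀) hr₀ hρ₁ ρ₂ τ₀
  refine ⟨2 / r₀ + 4 * |M + δm₀| / r₀ + C, by positivity, fun p hp v w hv hw y hy₁ hy₂ ↦ ?_⟩
  have hy1 : 1 ≤ ‖y‖ := hρ₁.trans hy₁.le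
  have key := hC (p.1 - δm₀, p.2) hp v w hv hw y hy₁ hy₂
  have hlin := abs_firstOrder_terms_le hr₀ (M + δm₀) (p.1 - δm₀, p.2) hy1 hv hw
  dsimp only at key hlin
  have hM : M + δm₀ + (p.1 - δm₀) = M + p.1 := by ring
  rw [hM] at key
  set X := cylH (M + p.1) ‖p.2‖ r₀ τ₀ (spinIsometry p.2) y v w - gbarRep (M + δm₀) r₀ y v w
  set L1 := (p.1 - δm₀) * (2 / r₀ * (⟪y, v⟫ * ⟪y, w⟫ / ‖y‖ ^ 2))
  set L2 := 2 * (M + δm₀) / (r₀ * ‖y‖ ^ 3) * (triple p.2 y v * ⟪y, w⟫ + ⟪y, v⟫ * triple p.2 y w)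
  have hX : |X| ≤ |L1| + |L2| + C * (|p.1 - δm₀| + ‖p.2‖) ^ 2 := by
    have h : X = (X - L1 + L2) + L1 - L2 := by ring
    calc |X| = |(X - L1 + L2) + L1 - L2| := by rw [← h]
      _ ≤ |X - L1 + L2| + |L1| + |L2| := by
          refine (abs_sub _ _).trans ?_
          linarith [abs_add_le (X - L1 + L2) L1]
      _ ≤ _ := by linarith
  have hsq : (|p.1 - δm₀| + ‖p.2‖) ^ 2 ≤ |p.1 - δm₀| + ‖p.2‖ := by
    have h0 : 0 ≤ |p.1 - δm₀| + ‖p.2‖ := by positivity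
    nlinarith
  calc |X| ≤ |L1| + |L2| + C * (|p.1 - δm₀| + ‖p.2‖) ^ 2 := hX
    _ ≤ (2 / r₀ + 4 * |M + δm₀| / r₀) * (|p.1 - δm₀| + ‖p.2‖) + C * (|p.1 - δm₀| + ‖p.2‖) := by
        gcongr
    _ = (2 / r₀ + 4 * |M + δm₀| / r₀ + C) * (|p.1 - δm₀| + ‖p.2‖) := by ring

/-- **Continuity of the metric field of the family at zero spin**: for `ρ₁ < ‖y‖ < ρ₂`
(`ρ₁ ≥ 1`), any `v, w` and `p₀ = (δm₀, 0)`, `p ↦ H[M + p.1, ‖p.2‖, R_{p.2}](y)(v, w)` is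
continuous at `p₀`. [cite: LiMei2020, p. 25] -/
theorem continuousAt_cylH_family_zero (M : ℝ) (hr₀ : 0 < r₀) (τ₀ : ℝ) {ρ₁ ρ₂ : ℝ} (hρ₁ : 1 ≤ ρ₁)
    {y : E3} (hy₁ : ρ₁ < ‖y‖) (hy₂ : ‖y‖ < ρ₂) (δm₀ : ℝ) (v w : E3) :
    ContinuousAt (fun p : ℝ × E3 ↦ cylH (M + p.1) ‖p.2‖ r₀ τ₀ (spinIsometry p.2) y v w)
      (δm₀, 0) := by
  obtain ⟨A, hA0, hA⟩ := exists_abs_cylH_family_sub_le_linear (r₀ := r₀) M hr₀ τ₀ hρ₁ ρ₂ δm₀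
  have hy1 : 1 ≤ ‖y‖ := hρ₁.trans hy₁.le
  -- reduce to unit vectors
  have hform : (fun p : ℝ × E3 ↦ cylH (M + p.1) ‖p.2‖ r₀ τ₀ (spinIsometry p.2) y v w) = fun p ↦
      ‖v‖ * ‖w‖ * cylH (M + p.1) ‖p.2‖ r₀ τ₀ (spinIsometry p.2) y (‖v‖⁻¹ • v) (‖w‖⁻¹ • w) := by
    funext p; exact apply_eq_norm_mul_norm_mul _ v w
  rw [hform]
  refine continuousAt_const.mul ?_
  set v' := ‖v‖⁻¹ • v
  set w' := ‖w‖⁻¹ • w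
  have hv' : ‖v'‖ ≤ 1 := norm_unitDir_le_one v
  have hw' : ‖w'‖ ≤ 1 := norm_unitDir_le_one w
  rw [Metric.continuousAt_iff]
  intro ε hε
  refine ⟨min (1 / 2) (ε / (4 * (A + 1))), by positivity, fun p hp ↦ ?_⟩
  have hp1 : dist p (δm₀, 0) < 1 / 2 := lt_of_lt_of_le hp (min_le_left _ _)
  have hpε : dist p (δm₀, 0) < ε / (4 * (A + 1)) := lt_of_lt_of_le hp (min_le_right _ _)
  have hq1 : |p.1 - δm₀| ≤ dist p (δm₀, 0) := by
    rw [Prod.dist_eq, Real.dist_eq]; exact le_max_left _ _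
  have hq2 : ‖p.2‖ ≤ dist p (δm₀, 0) := by
    rw [Prod.dist_eq, dist_zero_right]; exact le_max_right _ _
  have hs : |p.1 - δm₀| + ‖p.2‖ ≤ 2 * dist p (δm₀, 0) := by linarith
  have hs1 : |p.1 - δm₀| + ‖p.2‖ ≤ 1 := by linarith
  have h0 : cylH (M + (δm₀, (0 : E3)).1) ‖(δm₀, (0 : E3)).2‖ r₀ τ₀ (spinIsometry (δm₀, (0 : E3)).2)
      y v' w' = gbarRep (M + δm₀) r₀ y v' w' := by
    dsimp only
    rw [norm_zero]
    exact cylH_zero_spin_apply hr₀ τ₀ _ hy1 v' w'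
  rw [Real.dist_eq, h0]
  calc |cylH (M + p.1) ‖p.2‖ r₀ τ₀ (spinIsometry p.2) y v' w' - gbarRep (M + δm₀) r₀ y v' w'|
      ≤ A * (|p.1 - δm₀| + ‖p.2‖) := hA p hs1 v' w' hv' hw' y hy₁ hy₂
    _ ≤ A * (2 * dist p (δm₀, 0)) := by gcongr
    _ ≤ (A + 1) * (2 * (ε / (4 * (A + 1)))) := by gcongr; linarith
    _ = ε / 2 := by field_simp; ring
    _ < ε := by linarith

/-! ### The second fundamental form at zero spin -/

/-- **The first-order terms of the expansion of the second fundamental form are `O(|q|)` on unit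
vectors** (`ρ ≥ 1`, `r₀ > 0`, `A = 2m/r₀ − 1 > 0`). [folklore] -/
theorem abs_firstOrderK_terms_le (hr₀ : 0 < r₀) {m : ℝ} (hA : 0 < 2 * m / r₀ - 1) (q : ℝ × E3)
    {y v w : E3} (hy : 1 ≤ ‖y‖) (hv : ‖v‖ ≤ 1) (hw : ‖w‖ ≤ 1) :
    |q.1 * ((Real.sqrt (2 * m / r₀ - 1) / r₀ ^ 2 + m / (r₀ ^ 3 * Real.sqrt (2 * m / r₀ - 1))) *
            (⟪y, v⟫ * ⟪y, w⟫ / ‖y‖ ^ 2) -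
          1 / (Real.sqrt (2 * m / r₀ - 1) * ‖y‖ ^ 2) * (⟪v, w⟫ - ⟪y, v⟫ * ⟪y, w⟫ / ‖y‖ ^ 2))| +
        |m * Real.sqrt (2 * m / r₀ - 1) / (r₀ ^ 2 * ‖y‖ ^ 3) *
          (triple q.2 y v * ⟪y, w⟫ + ⟪y, v⟫ * triple q.2 y w)| ≤
      (|Real.sqrt (2 * m / r₀ - 1) / r₀ ^ 2 + m / (r₀ ^ 3 * Real.sqrt (2 * m / r₀ - 1))| +
          2 / Real.sqrt (2 * m / r₀ - 1) + 2 * |m| * Real.sqrt (2 * m / r₀ - 1) / r₀ ^ 2) *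
        (|q.1| + ‖q.2‖) := by
  have hρ : 0 < ‖y‖ := lt_of_lt_of_le one_pos hy
  set σ := Real.sqrt (2 * m / r₀ - 1) with hσ
  have hσ0 : 0 < σ := Real.sqrt_pos.2 hA
  set c₁ := σ / r₀ ^ 2 + m / (r₀ ^ 3 * σ) with hc₁
  have hI : |⟪y, v⟫ * ⟪y, w⟫ / ‖y‖ ^ 2| ≤ 1 := by
    rw [abs_div, abs_mul, abs_of_pos (pow_pos hρ 2), div_le_one (pow_pos hρ 2), sq]
    exact mul_le_mul (abs_inner_le_norm_of_unit hv) (abs_inner_le_norm_of_unit hw) (abs_nonneg _)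
      (norm_nonneg _)
  have hW : |⟪v, w⟫| ≤ 1 :=
    (abs_real_inner_le_norm v w).trans (mul_le_one₀ hv (norm_nonneg _) hw)
  have hc₂ : |1 / (σ * ‖y‖ ^ 2)| ≤ 1 / σ := by
    rw [abs_of_pos (by positivity)]
    exact div_le_div_of_nonneg_left zero_le_one hσ0
      (le_mul_of_one_le_right hσ0.le (one_le_pow₀ hy))
  have h1 : |q.1 * (c₁ * (⟪y, v⟫ * ⟪y, w⟫ / ‖y‖ ^ 2) -
      1 / (σ * ‖y‖ ^ 2) * (⟪v, w⟫ - ⟪y, v⟫ * ⟪y, w⟫ / ‖y‖ ^ 2))| ≤ (|c₁| + 2 / σ) * |q.1| := by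
    rw [abs_mul]
    have h : |c₁ * (⟪y, v⟫ * ⟪y, w⟫ / ‖y‖ ^ 2) -
        1 / (σ * ‖y‖ ^ 2) * (⟪v, w⟫ - ⟪y, v⟫ * ⟪y, w⟫ / ‖y‖ ^ 2)| ≤ |c₁| + 2 / σ := by
      calc _ ≤ |c₁ * (⟪y, v⟫ * ⟪y, w⟫ / ‖y‖ ^ 2)| +
            |1 / (σ * ‖y‖ ^ 2) * (⟪v, w⟫ - ⟪y, v⟫ * ⟪y, w⟫ / ‖y‖ ^ 2)| := abs_sub _ _
        _ ≤ |c₁| * 1 + 1 / σ * 2 := by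
            rw [abs_mul, abs_mul]
            refine add_le_add (mul_le_mul_of_nonneg_left hI (abs_nonneg _))
              (mul_le_mul hc₂ ((abs_sub _ _).trans (by linarith)) (abs_nonneg _) (by positivity))
        _ = |c₁| + 2 / σ := by ring
    calc |q.1| * _ ≤ |q.1| * (|c₁| + 2 / σ) := mul_le_mul_of_nonneg_left h (abs_nonneg _)
      _ = (|c₁| + 2 / σ) * |q.1| := by ring
  have hT : |triple q.2 y v * ⟪y, w⟫ + ⟪y, v⟫ * triple q.2 y w| ≤ 2 * ‖q.2‖ * ‖y‖ ^ 2 := by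
    calc |triple q.2 y v * ⟪y, w⟫ + ⟪y, v⟫ * triple q.2 y w|
        ≤ |triple q.2 y v| * |⟪y, w⟫| + |⟪y, v⟫| * |triple q.2 y w| := by
          refine (abs_add_le _ _).trans ?_; rw [abs_mul, abs_mul]
      _ ≤ ‖q.2‖ * ‖y‖ * ‖y‖ + ‖y‖ * (‖q.2‖ * ‖y‖) :=
          add_le_add (mul_le_mul (abs_triple_le hv) (abs_inner_le_norm_of_unit hw) (abs_nonneg _)
            (by positivity))
            (mul_le_mul (abs_inner_le_norm_of_unit hv) (abs_triple_le hw) (abs_nonneg _) (norm_nonneg _))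
      _ = 2 * ‖q.2‖ * ‖y‖ ^ 2 := by ring
  have h2 : |m * σ / (r₀ ^ 2 * ‖y‖ ^ 3) * (triple q.2 y v * ⟪y, w⟫ + ⟪y, v⟫ * triple q.2 y w)| ≤
      2 * |m| * σ / r₀ ^ 2 * ‖q.2‖ := by
    rw [abs_mul, abs_div, abs_mul, abs_of_pos hσ0, abs_of_pos (by positivity : (0 : ℝ) < r₀ ^ 2 * ‖y‖ ^ 3)]
    calc |m| * σ / (r₀ ^ 2 * ‖y‖ ^ 3) * |triple q.2 y v * ⟪y, w⟫ + ⟪y, v⟫ * triple q.2 y w|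
        ≤ |m| * σ / (r₀ ^ 2 * ‖y‖ ^ 3) * (2 * ‖q.2‖ * ‖y‖ ^ 2) :=
          mul_le_mul_of_nonneg_left hT (by positivity)
      _ = 2 * |m| * σ / r₀ ^ 2 * ‖q.2‖ * (‖y‖ ^ 2 / ‖y‖ ^ 3) := by ring
      _ ≤ 2 * |m| * σ / r₀ ^ 2 * ‖q.2‖ * 1 := by
          gcongr
          exact div_le_one_of_le₀ (pow_le_pow_right₀ hy (by norm_num)) (by positivity)
      _ = 2 * |m| * σ / r₀ ^ 2 * ‖q.2‖ := mul_one _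
  calc _ ≤ (|c₁| + 2 / σ) * |q.1| + 2 * |m| * σ / r₀ ^ 2 * ‖q.2‖ := add_le_add h1 h2
    _ ≤ (|c₁| + 2 / σ + 2 * |m| * σ / r₀ ^ 2) * (|q.1| + ‖q.2‖) := by
        have : 0 ≤ (|c₁| + 2 / σ) * ‖q.2‖ + 2 * |m| * σ / r₀ ^ 2 * |q.1| := by positivity
        nlinarith

/-- **Linear closeness of the second fundamental form of the family at zero spin, unit vectors**:
around `p₀ = (δm₀, 0)` with `0 < r₀ < 2(M + δm₀)`,
`|K[M + p.1, ‖p.2‖, R_{p.2}](y)(v,w) − k̄_{M + δm₀}(y)(v,w)| ≤ A (|p.1 − δm₀| + ‖p.2‖)` for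
`|p.1 − δm₀| + ‖p.2‖ ≤ δ`, from `exists_abs_cylK_family_le` around `M + δm₀`. [cite: LiMei2020, p. 25] -/
theorem exists_abs_cylK_family_sub_le_linear [Kerr.Facts] (M : ℝ) (hr₀ : 0 < r₀) (τ₀ : ℝ)
    {ρ₁ : ℝ} (hρ₁ : 1 ≤ ρ₁) (ρ₂ : ℝ) {δm₀ : ℝ} (h2M : r₀ < 2 * (M + δm₀)) :
    ∃ δ A : ℝ, 0 < δ ∧ 0 ≤ A ∧ ∀ p : ℝ × E3, |p.1 - δm₀| + ‖p.2‖ ≤ δ →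
      ∀ v w : E3, ‖v‖ ≤ 1 → ‖w‖ ≤ 1 → ∀ y : E3, ρ₁ < ‖y‖ → ‖y‖ < ρ₂ →
        |cylK (M + p.1) ‖p.2‖ hr₀ τ₀ (spinIsometry p.2) y v w - kbarRep (M + δm₀) r₀ y v w| ≤
          A * (|p.1 - δm₀| + ‖p.2‖) := by
  obtain ⟨δ, C, hδ, hC0, hC⟩ := exists_abs_cylK_family_le (M := M + δm₀) hr₀ h2M hρ₁ ρ₂ τ₀
  have hA := lapse_pos hr₀ h2M
  set σ := Real.sqrt (2 * (M + δm₀) / r₀ - 1) with hσ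
  refine ⟨min δ 1, |σ / r₀ ^ 2 + (M + δm₀) / (r₀ ^ 3 * σ)| + 2 / σ + 2 * |M + δm₀| * σ / r₀ ^ 2 + C,
    by positivity, by positivity, fun p hp v w hv hw y hy₁ hy₂ ↦ ?_⟩
  have hy1 : 1 ≤ ‖y‖ := hρ₁.trans hy₁.le
  have hpδ : |p.1 - δm₀| + ‖p.2‖ ≤ δ := hp.trans (min_le_left _ _)
  have hp1 : |p.1 - δm₀| + ‖p.2‖ ≤ 1 := hp.trans (min_le_right _ _)
  have key := hC (p.1 - δm₀, p.2) hpδ v w hv hw y hy₁ hy₂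
  have hlin := abs_firstOrderK_terms_le hr₀ hA (p.1 - δm₀, p.2) hy1 hv hw
  dsimp only at key hlin
  have hM : M + δm₀ + (p.1 - δm₀) = M + p.1 := by ring
  rw [hM] at key
  set X := cylK (M + p.1) ‖p.2‖ hr₀ τ₀ (spinIsometry p.2) y v w - kbarRep (M + δm₀) r₀ y v w
  set L1 := (p.1 - δm₀) * ((σ / r₀ ^ 2 + (M + δm₀) / (r₀ ^ 3 * σ)) * (⟪y, v⟫ * ⟪y, w⟫ / ‖y‖ ^ 2) -
    1 / (σ * ‖y‖ ^ 2) * (⟪v, w⟫ - ⟪y, v⟫ * ⟪y, w⟫ / ‖y‖ ^ 2))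
  set L2 := (M + δm₀) * σ / (r₀ ^ 2 * ‖y‖ ^ 3) * (triple p.2 y v * ⟪y, w⟫ + ⟪y, v⟫ * triple p.2 y w)
  have hX : |X| ≤ |L1| + |L2| + C * (|p.1 - δm₀| + ‖p.2‖) ^ 2 := by
    have h : X = (X - L1 + L2) + L1 - L2 := by ring
    calc |X| = |(X - L1 + L2) + L1 - L2| := by rw [← h]
      _ ≤ |X - L1 + L2| + |L1| + |L2| := by
          refine (abs_sub _ _).trans ?_
          linarith [abs_add_le (X - L1 + L2) L1]
      _ ≤ _ := by linarith
  have hsq : (|p.1 - δm₀| + ‖p.2‖) ^ 2 ≤ |p.1 - δm₀| + ‖p.2‖ := by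
    have h0 : 0 ≤ |p.1 - δm₀| + ‖p.2‖ := by positivity
    nlinarith
  calc |X| ≤ |L1| + |L2| + C * (|p.1 - δm₀| + ‖p.2‖) ^ 2 := hX
    _ ≤ (|σ / r₀ ^ 2 + (M + δm₀) / (r₀ ^ 3 * σ)| + 2 / σ + 2 * |M + δm₀| * σ / r₀ ^ 2) *
          (|p.1 - δm₀| + ‖p.2‖) + C * (|p.1 - δm₀| + ‖p.2‖) := by
        gcongr
    _ = _ := by ring

/-- **Continuity of the second fundamental form of the family at zero spin** (`ρ₁ < ‖y‖ < ρ₂`,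
`ρ₁ ≥ 1`, `0 < r₀ < 2(M + δm₀)`). [cite: LiMei2020, p. 25] -/
theorem continuousAt_cylK_family_zero [Kerr.Facts] (M : ℝ) (hr₀ : 0 < r₀) (τ₀ : ℝ) {ρ₁ ρ₂ : ℝ}
    (hρ₁ : 1 ≤ ρ₁) {y : E3} (hy₁ : ρ₁ < ‖y‖) (hy₂ : ‖y‖ < ρ₂) {δm₀ : ℝ}
    (h2M : r₀ < 2 * (M + δm₀)) (v w : E3) :
    ContinuousAt (fun p : ℝ × E3 ↦ cylK (M + p.1) ‖p.2‖ hr₀ τ₀ (spinIsometry p.2) y v w)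
      (δm₀, 0) := by
  obtain ⟨δ, A, hδ, hA0, hA⟩ :=
    exists_abs_cylK_family_sub_le_linear (r₀ := r₀) M hr₀ τ₀ hρ₁ ρ₂ h2M
  have hy1' : 1 < ‖y‖ := lt_of_le_of_lt hρ₁ hy₁
  have hform : (fun p : ℝ × E3 ↦ cylK (M + p.1) ‖p.2‖ hr₀ τ₀ (spinIsometry p.2) y v w) = fun p ↦
      ‖v‖ * ‖w‖ * cylK (M + p.1) ‖p.2‖ hr₀ τ₀ (spinIsometry p.2) y (‖v‖⁻¹ • v) (‖w‖⁻¹ • w) := by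
    funext p; exact apply_eq_norm_mul_norm_mul _ v w
  rw [hform]
  refine continuousAt_const.mul ?_
  set v' := ‖v‖⁻¹ • v
  set w' := ‖w‖⁻¹ • w
  have hv' : ‖v'‖ ≤ 1 := norm_unitDir_le_one v
  have hw' : ‖w'‖ ≤ 1 := norm_unitDir_le_one w
  rw [Metric.continuousAt_iff]
  intro ε hε
  refine ⟨min (δ / 2) (ε / (4 * (A + 1))), by positivity, fun p hp ↦ ?_⟩
  have hp1 : dist p (δm₀, 0) < δ / 2 := lt_of_lt_of_le hp (min_le_left _ _)
  have hpε : dist p (δm₀, 0) < ε / (4 * (A + 1)) := lt_of_lt_of_le hp (min_le_right _ _)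
  have hq1 : |p.1 - δm₀| ≤ dist p (δm₀, 0) := by
    rw [Prod.dist_eq, Real.dist_eq]; exact le_max_left _ _
  have hq2 : ‖p.2‖ ≤ dist p (δm₀, 0) := by
    rw [Prod.dist_eq, dist_zero_right]; exact le_max_right _ _
  have hs : |p.1 - δm₀| + ‖p.2‖ ≤ 2 * dist p (δm₀, 0) := by linarith
  have hsδ : |p.1 - δm₀| + ‖p.2‖ ≤ δ := by linarith
  have h0 : cylK (M + (δm₀, (0 : E3)).1) ‖(δm₀, (0 : E3)).2‖ hr₀ τ₀ (spinIsometry (δm₀, (0 : E3)).2)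
      y v' w' = kbarRep (M + δm₀) r₀ y v' w' := by
    dsimp only
    rw [norm_zero]
    exact cylK_zero_spin_apply hr₀ h2M τ₀ _ hy1' v' w'
  rw [Real.dist_eq, h0]
  calc |cylK (M + p.1) ‖p.2‖ hr₀ τ₀ (spinIsometry p.2) y v' w' - kbarRep (M + δm₀) r₀ y v' w'|
      ≤ A * (|p.1 - δm₀| + ‖p.2‖) := hA p hsδ v' w' hv' hw' y hy₁ hy₂
    _ ≤ A * (2 * dist p (δm₀, 0)) := by gcongr
    _ ≤ (A + 1) * (2 * (ε / (4 * (A + 1)))) := by gcongr; linarith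
    _ = ε / 2 := by field_simp; ring
    _ < ε := by linarith

/-! ### Continuity of the family at every admissible parameter -/

/-- **The metric field of the four-parameter Kerr cylinder family is continuous in `p`** at every
`p₀` near which the parameters `(M + p.1, ‖p.2‖)` are admissible (`|a| < m`, `r₋ < r₀ < r₊`), for
`ρ₁ < ‖y‖ < ρ₂` (`ρ₁ ≥ 1`) and all `v, w`. [cite: LiMei2020, proof of Prop. 4.1, pp. 22, 25] -/
theorem continuousAt_cylH_family [Kerr.Facts] (hr₀ : 0 < r₀) (τ₀ : ℝ) {ρ₁ ρ₂ : ℝ} (hρ₁ : 1 ≤ ρ₁)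
    {y : E3} (hy₁ : ρ₁ < ‖y‖) (hy₂ : ‖y‖ < ρ₂) (v w : E3) {p₀ : ℝ × E3}
    (hadm : ∀ᶠ p : ℝ × E3 in 𝓝 p₀, |‖p.2‖| < M + p.1 ∧ Kerr.rMinus (M + p.1) ‖p.2‖ < r₀ ∧
      r₀ < Kerr.rPlus (M + p.1) ‖p.2‖) :
    ContinuousAt (fun p : ℝ × E3 ↦ cylH (M + p.1) ‖p.2‖ r₀ τ₀ (spinIsometry p.2) y v w) p₀ := by
  have hy0 : y ≠ 0 := by
    rintro rfl; rw [norm_zero] at hy₁; linarith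
  by_cases hb : p₀.2 = 0
  · have hp₀ : p₀ = (p₀.1, (0 : E3)) := Prod.ext rfl hb
    rw [hp₀]
    exact continuousAt_cylH_family_zero M hr₀ τ₀ hρ₁ hy₁ hy₂ p₀.1 v w
  by_cases hax : ‖p₀.2‖⁻¹ • p₀.2 = axisVec
  · -- second chart, then switch back by canonicity on a neighbourhood
    have hc := continuousAt_cylH_chart (M := M) hr₀ τ₀ (S := spinIsometry₂)
      (continuousAt_spinIsometry₂ hb (ne_neg_axisVec_of_eq hax)) hy0 v w
    refine hc.congr ?_
    have hne : ∀ᶠ p : ℝ × E3 in 𝓝 p₀, p.2 ≠ 0 :=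
      (isOpen_ne.preimage continuous_snd).mem_nhds hb
    filter_upwards [hadm, hne] with p hp hpne
    rw [cylH_spinIsometry₂_eq hpne hp.1 hp.2.1 hp.2.2 τ₀ y]
  · exact continuousAt_cylH_chart (M := M) hr₀ τ₀ (S := spinIsometry)
      (continuousAt_spinIsometry hb hax) hy0 v w

/-- **The second fundamental form field of the family is continuous in `p`** at every `p₀` near
which the parameters are admissible. [cite: LiMei2020, proof of Prop. 4.1, pp. 22, 25] -/
theorem continuousAt_cylK_family [Kerr.Facts] (hr₀ : 0 < r₀) (τ₀ : ℝ) {ρ₁ ρ₂ : ℝ} (hρ₁ : 1 ≤ ρ₁)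
    {y : E3} (hy₁ : ρ₁ < ‖y‖) (hy₂ : ‖y‖ < ρ₂) (v w : E3) {p₀ : ℝ × E3}
    (hadm : ∀ᶠ p : ℝ × E3 in 𝓝 p₀, |‖p.2‖| < M + p.1 ∧ Kerr.rMinus (M + p.1) ‖p.2‖ < r₀ ∧
      r₀ < Kerr.rPlus (M + p.1) ‖p.2‖) :
    ContinuousAt (fun p : ℝ × E3 ↦ cylK (M + p.1) ‖p.2‖ hr₀ τ₀ (spinIsometry p.2) y v w) p₀ := by
  have hy0 : y ≠ 0 := by
    rintro rfl; rw [norm_zero] at hy₁; linarith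
  obtain ⟨ha0, h₁0, h₂0⟩ := hadm.self_of_nhds
  by_cases hb : p₀.2 = 0
  · have hp₀ : p₀ = (p₀.1, (0 : E3)) := Prod.ext rfl hb
    have hm : 0 < M + p₀.1 := lt_of_le_of_lt (abs_nonneg _) ha0
    have h2M : r₀ < 2 * (M + p₀.1) := by
      have h := h₂0
      have hr : Kerr.rPlus (M + p₀.1) 0 = 2 * (M + p₀.1) := by
        rw [Kerr.rPlus, sq (0 : ℝ), mul_zero, sub_zero, Real.sqrt_sq hm.le]; ring
      rw [hb, norm_zero, hr] at h
      exact h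
    rw [hp₀]
    exact continuousAt_cylK_family_zero M hr₀ τ₀ hρ₁ hy₁ hy₂ h2M v w
  have hΔ : r₀ ^ 2 - 2 * (M + p₀.1) * r₀ + ‖p₀.2‖ ^ 2 < 0 := Kerr.delta_neg ha0.le h₁0 h₂0
  by_cases hax : ‖p₀.2‖⁻¹ • p₀.2 = axisVec
  · have hc := continuousAt_cylK_chart (M := M) hr₀ τ₀ (S := spinIsometry₂)
      (continuousAt_spinIsometry₂ hb (ne_neg_axisVec_of_eq hax)) hΔ hy0 v w
    refine hc.congr ?_
    have hne : ∀ᶠ p : ℝ × E3 in 𝓝 p₀, p.2 ≠ 0 :=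
      (isOpen_ne.preimage continuous_snd).mem_nhds hb
    filter_upwards [hadm, hne] with p hp hpne
    exact congrArg (fun T : E3 →L[ℝ] E3 →L[ℝ] ℝ ↦ T v w)
      (cylK_spinIsometry₂_eq hpne hp.1 hp.2.1 hp.2.2 τ₀ y)
  · exact continuousAt_cylK_chart (M := M) hr₀ τ₀ (S := spinIsometry)
      (continuousAt_spinIsometry hb hax) hΔ hy0 v w


end Charts

/-! ### Continuity of the outer-layer linearised obstruction functionals in `p` -/

section Outer

variable [Kerr.Facts] {M r₀ : ℝ}

omit [Kerr.Facts] in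
/-- Admissibility of the parameters `(M + p.1, ‖p.2‖)` holds near every point of the open box
`{|p.1| + ‖p.2‖ < δ_B}` of `kerrBox`. [cite: LiMei2020, proof of Prop. 4.1, p. 22] -/
theorem exists_eventually_admissible (hr₀ : 0 < r₀) (h2M : r₀ < 2 * M) :
    ∃ δB : ℝ, 0 < δB ∧ ∀ p₀ : ℝ × E3, |p₀.1| + ‖p₀.2‖ < δB →
      ∀ᶠ p : ℝ × E3 in 𝓝 p₀, |‖p.2‖| < M + p.1 ∧ Kerr.rMinus (M + p.1) ‖p.2‖ < r₀ ∧
        r₀ < Kerr.rPlus (M + p.1) ‖p.2‖ := by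
  obtain ⟨δB, hδB, hbox⟩ := kerrBox hr₀ h2M
  refine ⟨δB, hδB, fun p₀ hp₀ ↦ ?_⟩
  have hO : IsOpen {p : ℝ × E3 | |p.1| + ‖p.2‖ < δB} := isOpen_lt (by fun_prop) continuous_const
  filter_upwards [hO.mem_nhds hp₀] with p hp
  exact hbox (M + p.1) ‖p.2‖ (by rw [add_sub_cancel_left, abs_norm]; exact le_of_lt hp)

/-- **The exact `∂_t`-integrand is continuous in `p`** at admissible `p₀`, for `y` in the shell.
[cite: LiMei2020, proof of Prop. 4.1, p. 25] -/
theorem continuousAt_timeIntegrandWith_family (hr₀ : 0 < r₀) (τ₀ : ℝ) (R₀ : E3 →ₗᵢ[ℝ] E3)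
    {ρ₁ ρ₂ : ℝ} (hρ₁ : 1 ≤ ρ₁) (χ₀ : ℝ → ℝ) {y : E3} (hy₁ : ρ₁ < ‖y‖) (hy₂ : ‖y‖ < ρ₂)
    {p₀ : ℝ × E3}
    (hadm : ∀ᶠ p : ℝ × E3 in 𝓝 p₀, |‖p.2‖| < M + p.1 ∧ Kerr.rMinus (M + p.1) ‖p.2‖ < r₀ ∧
      r₀ < Kerr.rPlus (M + p.1) ‖p.2‖) :
    ContinuousAt (fun p : ℝ × E3 ↦ timeIntegrandWith M r₀ χ₀
        (cylH (M + p.1) ‖p.2‖ r₀ τ₀ (spinIsometry p.2) y - cylH M 0 r₀ τ₀ R₀ y)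
        (cylK (M + p.1) ‖p.2‖ hr₀ τ₀ (spinIsometry p.2) y - cylK M 0 hr₀ τ₀ R₀ y) y) p₀ := by
  have hH : ∀ v w : E3, ContinuousAt
      (fun p : ℝ × E3 ↦ cylH (M + p.1) ‖p.2‖ r₀ τ₀ (spinIsometry p.2) y v w) p₀ := fun v w ↦
    continuousAt_cylH_family hr₀ τ₀ hρ₁ hy₁ hy₂ v w hadm
  have hK : ∀ v w : E3, ContinuousAt
      (fun p : ℝ × E3 ↦ cylK (M + p.1) ‖p.2‖ hr₀ τ₀ (spinIsometry p.2) y v w) p₀ := fun v w ↦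
    continuousAt_cylK_family hr₀ τ₀ hρ₁ hy₁ hy₂ v w hadm
  have hSH : ContinuousAt (fun p : ℝ × E3 ↦ ∑ i, (cylH (M + p.1) ‖p.2‖ r₀ τ₀ (spinIsometry p.2) y -
      cylH M 0 r₀ τ₀ R₀ y) (EuclideanSpace.single i 1) (EuclideanSpace.single i 1)) p₀ := by
    refine tendsto_finsetSum _ fun i _ ↦ ?_
    simp only [sub_apply]
    exact (hH _ _).sub continuousAt_const
  have hSK : ContinuousAt (fun p : ℝ × E3 ↦ ∑ i, (cylK (M + p.1) ‖p.2‖ hr₀ τ₀ (spinIsometry p.2) y -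
      cylK M 0 hr₀ τ₀ R₀ y) (EuclideanSpace.single i 1) (EuclideanSpace.single i 1)) p₀ := by
    refine tendsto_finsetSum _ fun i _ ↦ ?_
    simp only [sub_apply]
    exact (hK _ _).sub continuousAt_const
  have heH : ContinuousAt (fun p : ℝ × E3 ↦ (cylH (M + p.1) ‖p.2‖ r₀ τ₀ (spinIsometry p.2) y -
      cylH M 0 r₀ τ₀ R₀ y) y y) p₀ := by
    simp only [sub_apply]; exact (hH _ _).sub continuousAt_const
  have heK : ContinuousAt (fun p : ℝ × E3 ↦ (cylK (M + p.1) ‖p.2‖ hr₀ τ₀ (spinIsometry p.2) y -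
      cylK M 0 hr₀ τ₀ R₀ y) y y) p₀ := by
    simp only [sub_apply]; exact (hK _ _).sub continuousAt_const
  unfold timeIntegrandWith
  exact continuousAt_const.mul
    (((continuousAt_const.mul (hSH.sub (heH.div_const _))).add
      (continuousAt_const.mul (hSK.sub (heK.div_const _)))))

/-- **The exact `Ω_ξ`-integrand is continuous in `p`** at admissible `p₀`, for `y` in the shell.
[cite: LiMei2020, proof of Prop. 4.1, p. 25] -/
theorem continuousAt_rotIntegrandWith_family (hr₀ : 0 < r₀) (τ₀ : ℝ) (R₀ : E3 →ₗᵢ[ℝ] E3)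
    {ρ₁ ρ₂ : ℝ} (hρ₁ : 1 ≤ ρ₁) (χ₀ : ℝ → ℝ) (ξ : E3) {y : E3} (hy₁ : ρ₁ < ‖y‖) (hy₂ : ‖y‖ < ρ₂)
    {p₀ : ℝ × E3}
    (hadm : ∀ᶠ p : ℝ × E3 in 𝓝 p₀, |‖p.2‖| < M + p.1 ∧ Kerr.rMinus (M + p.1) ‖p.2‖ < r₀ ∧
      r₀ < Kerr.rPlus (M + p.1) ‖p.2‖) :
    ContinuousAt (fun p : ℝ × E3 ↦ rotIntegrandWith M r₀ χ₀ ξ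
        (cylH (M + p.1) ‖p.2‖ r₀ τ₀ (spinIsometry p.2) y - cylH M 0 r₀ τ₀ R₀ y)
        (cylK (M + p.1) ‖p.2‖ hr₀ τ₀ (spinIsometry p.2) y - cylK M 0 hr₀ τ₀ R₀ y) y) p₀ := by
  have heH : ContinuousAt (fun p : ℝ × E3 ↦ (cylH (M + p.1) ‖p.2‖ r₀ τ₀ (spinIsometry p.2) y -
      cylH M 0 r₀ τ₀ R₀ y) (crossCLM ξ y) y) p₀ := by
    simp only [sub_apply]
    exact (continuousAt_cylH_family hr₀ τ₀ hρ₁ hy₁ hy₂ _ _ hadm).sub continuousAt_const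
  have heK : ContinuousAt (fun p : ℝ × E3 ↦ (cylK (M + p.1) ‖p.2‖ hr₀ τ₀ (spinIsometry p.2) y -
      cylK M 0 hr₀ τ₀ R₀ y) (crossCLM ξ y) y) p₀ := by
    simp only [sub_apply]
    exact (continuousAt_cylK_family hr₀ τ₀ hρ₁ hy₁ hy₂ _ _ hadm).sub continuousAt_const
  unfold rotIntegrandWith
  exact continuousAt_const.mul ((continuousAt_const.mul heH).add (continuousAt_const.mul heK))

omit [Kerr.Facts] in
/-- `|χ₀'(ρ)|/ρ² ≤ |χ₀'(ρ)|` when `χ₀'` is supported in `1 ≤ ρ`. [folklore] -/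
theorem abs_deriv_div_norm_sq_le {χ₀ : ℝ → ℝ} {t s : ℝ} (ht : 1 ≤ t)
    (h1 : ∀ r, |r| ≤ t → χ₀ r = 1) (h0 : ∀ r, s ≤ |r| → χ₀ r = 0) (y : E3) :
    |deriv χ₀ ‖y‖ / ‖y‖ ^ 2| ≤ |deriv χ₀ ‖y‖| := by
  by_cases hd : deriv χ₀ ‖y‖ = 0
  · rw [hd, zero_div, abs_zero]
  have hy : 1 ≤ ‖y‖ := ht.trans (norm_mem_Icc_of_deriv_ne_zero h1 h0 hd).1
  rw [abs_div, abs_of_pos (by positivity : (0 : ℝ) < ‖y‖ ^ 2)]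
  exact div_le_self (abs_nonneg _) (one_le_pow₀ hy)

/-- **Pointwise bound for the exact `∂_t`-integrand on the parameter ball**:
`|timeIntegrandWith(H[p] − G₀, K[p] − K₀)(y)| ≤ (2s + K₀ s²)|χ₀'(‖y‖)|`, `s = |p.1| + ‖p.2‖ ≤ min 1 δ_K`,
`K₀ = √A(|c_G| 4C_H + 4C_K)` — the first-order part `−2δm χ₀'/ρ²` plus the `O(|p|²)` remainder
(constants of `exists_abs_cylH/K_sub_sub_firstOrderH/K_le`). [cite: LiMei2020, proof of Prop. 4.1, p. 25] -/
theorem abs_timeIntegrandWith_family_le (hr₀ : 0 < r₀) (h2M : r₀ < 2 * M) (τ₀ : ℝ)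
    (R₀ : E3 →ₗᵢ[ℝ] E3) {ρ₁ ρ₂ t s : ℝ} (hρ₁ : 1 ≤ ρ₁) (hρt : ρ₁ < t) (hsρ : s < ρ₂)
    {χ₀ : ℝ → ℝ} (h1 : ∀ r, |r| ≤ t → χ₀ r = 1) (h0 : ∀ r, s ≤ |r| → χ₀ r = 0) {CH δK CK : ℝ}
    (hCH : ∀ p : ℝ × E3, |p.1| + ‖p.2‖ ≤ 1 → ∀ (v w : E3), ‖v‖ ≤ 1 → ‖w‖ ≤ 1 →
      ∀ y : E3, ρ₁ < ‖y‖ → ‖y‖ < ρ₂ →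
        |cylH (M + p.1) ‖p.2‖ r₀ τ₀ (spinIsometry p.2) y v w -
            cylH M 0 r₀ τ₀ (spinIsometry p.2) y v w - firstOrderH M r₀ p y v w| ≤
          CH * (|p.1| + ‖p.2‖) ^ 2)
    (hCK : ∀ p : ℝ × E3, |p.1| + ‖p.2‖ ≤ δK → ∀ (v w : E3), ‖v‖ ≤ 1 → ‖w‖ ≤ 1 →
      ∀ y : E3, ρ₁ < ‖y‖ → ‖y‖ < ρ₂ →
        |cylK (M + p.1) ‖p.2‖ hr₀ τ₀ (spinIsometry p.2) y v w -
            cylK M 0 hr₀ τ₀ (spinIsometry p.2) y v w - firstOrderK M r₀ p y v w| ≤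
          CK * (|p.1| + ‖p.2‖) ^ 2)
    {p : ℝ × E3} (hp1 : |p.1| + ‖p.2‖ ≤ 1) (hpK : |p.1| + ‖p.2‖ ≤ δK) (y : E3) :
    |timeIntegrandWith M r₀ χ₀
        (cylH (M + p.1) ‖p.2‖ r₀ τ₀ (spinIsometry p.2) y - cylH M 0 r₀ τ₀ R₀ y)
        (cylK (M + p.1) ‖p.2‖ hr₀ τ₀ (spinIsometry p.2) y - cylK M 0 hr₀ τ₀ R₀ y) y| ≤
      (2 * (|p.1| + ‖p.2‖) + Real.sqrt (2 * M / r₀ - 1) *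
          (|(M - r₀) / (2 * r₀ ^ 2 * Real.sqrt (2 * M / r₀ - 1))| * (4 * CH) + 4 * CK) *
            (|p.1| + ‖p.2‖) ^ 2) * |deriv χ₀ ‖y‖| := by
  have ht1 : 1 ≤ t := hρ₁.trans hρt.le
  by_cases hd : deriv χ₀ ‖y‖ = 0
  · rw [timeIntegrandWith_eq_zero M r₀ _ _ hd, abs_zero, hd, abs_zero, mul_zero]
  obtain ⟨hty, hys⟩ := norm_mem_Icc_of_deriv_ne_zero h1 h0 hd
  have hy1 : ρ₁ < ‖y‖ := lt_of_lt_of_le hρt hty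
  have hy2 : ‖y‖ < ρ₂ := lt_of_le_of_lt hys hsρ
  have hy1' : 1 ≤ ‖y‖ := hρ₁.trans hy1.le
  have hy1'' : 1 < ‖y‖ := lt_of_lt_of_le (lt_of_le_of_lt hρ₁ hρt) hty
  have hbH : ∀ v w : E3, ‖v‖ ≤ 1 → ‖w‖ ≤ 1 →
      |(cylH (M + p.1) ‖p.2‖ r₀ τ₀ (spinIsometry p.2) y - cylH M 0 r₀ τ₀ R₀ y -
        firstOrderH M r₀ p y) v w| ≤ CH * (|p.1| + ‖p.2‖) ^ 2 := by
    intro v w hv hw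
    have h := hCH p hp1 v w hv hw y hy1 hy2
    rw [cylH_zero_spin_apply hr₀ τ₀ (spinIsometry p.2) hy1'] at h
    rw [sub_apply, sub_apply, sub_apply, sub_apply, cylH_zero_spin_apply hr₀ τ₀ R₀ hy1']
    exact h
  have hbK : ∀ v w : E3, ‖v‖ ≤ 1 → ‖w‖ ≤ 1 →
      |(cylK (M + p.1) ‖p.2‖ hr₀ τ₀ (spinIsometry p.2) y - cylK M 0 hr₀ τ₀ R₀ y -
        firstOrderK M r₀ p y) v w| ≤ CK * (|p.1| + ‖p.2‖) ^ 2 := by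
    intro v w hv hw
    have h := hCK p hpK v w hv hw y hy1 hy2
    rw [cylK_zero_spin_apply hr₀ h2M τ₀ (spinIsometry p.2) hy1''] at h
    rw [sub_apply, sub_apply, sub_apply, sub_apply, cylK_zero_spin_apply hr₀ h2M τ₀ R₀ hy1'']
    exact h
  have hb := abs_timeIntegrandWith_le hr₀ h2M χ₀ hbH hbK y
  rw [timeIntegrandWith_sub] at hb
  set F := timeIntegrandWith M r₀ χ₀
    (cylH (M + p.1) ‖p.2‖ r₀ τ₀ (spinIsometry p.2) y - cylH M 0 r₀ τ₀ R₀ y)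
    (cylK (M + p.1) ‖p.2‖ hr₀ τ₀ (spinIsometry p.2) y - cylK M 0 hr₀ τ₀ R₀ y) y
  set F₀ := timeIntegrandWith M r₀ χ₀ (firstOrderH M r₀ p y) (firstOrderK M r₀ p y) y
  have hF₀ : |F₀| ≤ 2 * (|p.1| + ‖p.2‖) * |deriv χ₀ ‖y‖| := by
    have h : F₀ = -(2 * p.1) * (deriv χ₀ ‖y‖ / ‖y‖ ^ 2) := timeIntegrand_firstOrder_eq hr₀ h2M p χ₀ y
    rw [h, abs_mul, abs_neg, abs_mul, abs_two]
    exact mul_le_mul (by linarith [norm_nonneg p.2]) (abs_deriv_div_norm_sq_le ht1 h1 h0 y)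
      (abs_nonneg _) (by positivity)
  have hsplit : |F| ≤ |F₀| + |F - F₀| := by
    have h := abs_add_le F₀ (F - F₀)
    rwa [add_sub_cancel] at h
  refine hsplit.trans ((add_le_add hF₀ hb).trans (le_of_eq ?_))
  ring

/-- **Pointwise bound for the exact `Ω_ξ`-integrand on the parameter ball** (`‖ξ‖ ≤ 1`):
`|rotIntegrandWith(H[p] − G₀, K[p] − K₀)(y)| ≤ (6|M| s + K₁ s²)|χ₀'(‖y‖)|`, `s = |p.1| + ‖p.2‖`,
`K₁ = r₀ C_H + r₀² C_K/√A`. [cite: LiMei2020, proof of Prop. 4.1, p. 25] -/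
theorem abs_rotIntegrandWith_family_le (hr₀ : 0 < r₀) (h2M : r₀ < 2 * M) (τ₀ : ℝ)
    (R₀ : E3 →ₗᵢ[ℝ] E3) {ρ₁ ρ₂ t s : ℝ} (hρ₁ : 1 ≤ ρ₁) (hρt : ρ₁ < t) (hsρ : s < ρ₂)
    {χ₀ : ℝ → ℝ} (h1 : ∀ r, |r| ≤ t → χ₀ r = 1) (h0 : ∀ r, s ≤ |r| → χ₀ r = 0) {CH δK CK : ℝ}
    (hCH : ∀ p : ℝ × E3, |p.1| + ‖p.2‖ ≤ 1 → ∀ (v w : E3), ‖v‖ ≤ 1 → ‖w‖ ≤ 1 →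
      ∀ y : E3, ρ₁ < ‖y‖ → ‖y‖ < ρ₂ →
        |cylH (M + p.1) ‖p.2‖ r₀ τ₀ (spinIsometry p.2) y v w -
            cylH M 0 r₀ τ₀ (spinIsometry p.2) y v w - firstOrderH M r₀ p y v w| ≤
          CH * (|p.1| + ‖p.2‖) ^ 2)
    (hCK : ∀ p : ℝ × E3, |p.1| + ‖p.2‖ ≤ δK → ∀ (v w : E3), ‖v‖ ≤ 1 → ‖w‖ ≤ 1 →
      ∀ y : E3, ρ₁ < ‖y‖ → ‖y‖ < ρ₂ →
        |cylK (M + p.1) ‖p.2‖ hr₀ τ₀ (spinIsometry p.2) y v w -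
            cylK M 0 hr₀ τ₀ (spinIsometry p.2) y v w - firstOrderK M r₀ p y v w| ≤
          CK * (|p.1| + ‖p.2‖) ^ 2)
    {p : ℝ × E3} (hp1 : |p.1| + ‖p.2‖ ≤ 1) (hpK : |p.1| + ‖p.2‖ ≤ δK) {ξ : E3} (hξ : ‖ξ‖ ≤ 1)
    (y : E3) :
    |rotIntegrandWith M r₀ χ₀ ξ
        (cylH (M + p.1) ‖p.2‖ r₀ τ₀ (spinIsometry p.2) y - cylH M 0 r₀ τ₀ R₀ y)
        (cylK (M + p.1) ‖p.2‖ hr₀ τ₀ (spinIsometry p.2) y - cylK M 0 hr₀ τ₀ R₀ y) y| ≤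
      (6 * |M| * (|p.1| + ‖p.2‖) + (r₀ * CH + r₀ ^ 2 / Real.sqrt (2 * M / r₀ - 1) * CK) *
          (|p.1| + ‖p.2‖) ^ 2) * |deriv χ₀ ‖y‖| := by
  have ht1 : 1 ≤ t := hρ₁.trans hρt.le
  by_cases hd : deriv χ₀ ‖y‖ = 0
  · rw [rotIntegrandWith_eq_zero M r₀ ξ _ _ hd, abs_zero, hd, abs_zero, mul_zero]
  obtain ⟨hty, hys⟩ := norm_mem_Icc_of_deriv_ne_zero h1 h0 hd
  have hy1 : ρ₁ < ‖y‖ := lt_of_lt_of_le hρt hty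
  have hy2 : ‖y‖ < ρ₂ := lt_of_le_of_lt hys hsρ
  have hy1' : 1 ≤ ‖y‖ := hρ₁.trans hy1.le
  have hy1'' : 1 < ‖y‖ := lt_of_lt_of_le (lt_of_le_of_lt hρ₁ hρt) hty
  have hbH : ∀ v w : E3, ‖v‖ ≤ 1 → ‖w‖ ≤ 1 →
      |(cylH (M + p.1) ‖p.2‖ r₀ τ₀ (spinIsometry p.2) y - cylH M 0 r₀ τ₀ R₀ y -
        firstOrderH M r₀ p y) v w| ≤ CH * (|p.1| + ‖p.2‖) ^ 2 := by
    intro v w hv hw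
    have h := hCH p hp1 v w hv hw y hy1 hy2
    rw [cylH_zero_spin_apply hr₀ τ₀ (spinIsometry p.2) hy1'] at h
    rw [sub_apply, sub_apply, sub_apply, sub_apply, cylH_zero_spin_apply hr₀ τ₀ R₀ hy1']
    exact h
  have hbK : ∀ v w : E3, ‖v‖ ≤ 1 → ‖w‖ ≤ 1 →
      |(cylK (M + p.1) ‖p.2‖ hr₀ τ₀ (spinIsometry p.2) y - cylK M 0 hr₀ τ₀ R₀ y -
        firstOrderK M r₀ p y) v w| ≤ CK * (|p.1| + ‖p.2‖) ^ 2 := by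
    intro v w hv hw
    have h := hCK p hpK v w hv hw y hy1 hy2
    rw [cylK_zero_spin_apply hr₀ h2M τ₀ (spinIsometry p.2) hy1''] at h
    rw [sub_apply, sub_apply, sub_apply, sub_apply, cylK_zero_spin_apply hr₀ h2M τ₀ R₀ hy1'']
    exact h
  have hb := abs_rotIntegrandWith_le hr₀ h2M χ₀ hξ hbH hbK y
  rw [rotIntegrandWith_sub] at hb
  set F := rotIntegrandWith M r₀ χ₀ ξ
    (cylH (M + p.1) ‖p.2‖ r₀ τ₀ (spinIsometry p.2) y - cylH M 0 r₀ τ₀ R₀ y)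
    (cylK (M + p.1) ‖p.2‖ hr₀ τ₀ (spinIsometry p.2) y - cylK M 0 hr₀ τ₀ R₀ y) y
  set F₀ := rotIntegrandWith M r₀ χ₀ ξ (firstOrderH M r₀ p y) (firstOrderK M r₀ p y) y
  have hdq := abs_deriv_div_norm_sq_le ht1 h1 h0 y
  have hF₀ : |F₀| ≤ 6 * |M| * (|p.1| + ‖p.2‖) * |deriv χ₀ ‖y‖| := by
    have h : F₀ = 3 * M * (deriv χ₀ ‖y‖ / ‖y‖ ^ 2) * ⟪p.2, ξ⟫ -
        3 * M * (deriv χ₀ ‖y‖ / ‖y‖ ^ 2 * (⟪p.2, ‖y‖⁻¹ • y⟫ * ⟪‖y‖⁻¹ • y, ξ⟫)) :=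
      rotIntegrand_firstOrder_eq hr₀ h2M p χ₀ ξ y
    have hi1 : |⟪p.2, ξ⟫| ≤ ‖p.2‖ :=
      (abs_real_inner_le_norm _ _).trans (mul_le_of_le_one_right (norm_nonneg _) hξ)
    have hi2 : |⟪p.2, ‖y‖⁻¹ • y⟫ * ⟪‖y‖⁻¹ • y, ξ⟫| ≤ ‖p.2‖ := by
      have h := abs_inner_unitDir_mul_le p.2 ξ y
      rw [Real.norm_eq_abs] at h
      exact h.trans (mul_le_of_le_one_right (norm_nonneg _) hξ)
    rw [h]
    calc |3 * M * (deriv χ₀ ‖y‖ / ‖y‖ ^ 2) * ⟪p.2, ξ⟫ -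
          3 * M * (deriv χ₀ ‖y‖ / ‖y‖ ^ 2 * (⟪p.2, ‖y‖⁻¹ • y⟫ * ⟪‖y‖⁻¹ • y, ξ⟫))|
        ≤ |3 * M * (deriv χ₀ ‖y‖ / ‖y‖ ^ 2) * ⟪p.2, ξ⟫| +
          |3 * M * (deriv χ₀ ‖y‖ / ‖y‖ ^ 2 * (⟪p.2, ‖y‖⁻¹ • y⟫ * ⟪‖y‖⁻¹ • y, ξ⟫))| := abs_sub _ _
      _ = 3 * |M| * (|deriv χ₀ ‖y‖ / ‖y‖ ^ 2| * |⟪p.2, ξ⟫|) +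
          3 * |M| * (|deriv χ₀ ‖y‖ / ‖y‖ ^ 2| * |⟪p.2, ‖y‖⁻¹ • y⟫ * ⟪‖y‖⁻¹ • y, ξ⟫|) := by
          simp only [abs_mul]
          rw [abs_of_pos (by norm_num : (0 : ℝ) < 3)]
          ring
      _ ≤ 3 * |M| * (|deriv χ₀ ‖y‖| * ‖p.2‖) + 3 * |M| * (|deriv χ₀ ‖y‖| * ‖p.2‖) := by
          gcongr
      _ ≤ 6 * |M| * (|p.1| + ‖p.2‖) * |deriv χ₀ ‖y‖| := by
          have : 0 ≤ |M| * |p.1| * |deriv χ₀ ‖y‖| := by positivity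
          nlinarith
  have hrem : |F - F₀| ≤ (r₀ * CH + r₀ ^ 2 / Real.sqrt (2 * M / r₀ - 1) * CK) *
      (|p.1| + ‖p.2‖) ^ 2 * |deriv χ₀ ‖y‖| := by
    have hCH0 := nonneg_of_unit_bound _ hbH
    have hCK0 := nonneg_of_unit_bound _ hbK
    have hsA : 0 < Real.sqrt (2 * M / r₀ - 1) := Real.sqrt_pos.2 (lapse_pos hr₀ h2M)
    have hnum : 0 ≤ |deriv χ₀ ‖y‖| * (r₀ * (CH * (|p.1| + ‖p.2‖) ^ 2) +
        r₀ ^ 2 / Real.sqrt (2 * M / r₀ - 1) * (CK * (|p.1| + ‖p.2‖) ^ 2)) := by positivity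
    refine hb.trans ((div_le_self hnum hy1').trans (le_of_eq ?_))
    ring
  have hsplit : |F| ≤ |F₀| + |F - F₀| := by
    have h := abs_add_le F₀ (F - F₀)
    rwa [add_sub_cancel] at h
  refine hsplit.trans ((add_le_add hF₀ hrem).trans (le_of_eq ?_))
  ring

/-- **The outer-layer linearised `∂_t`-obstruction of the Kerr family is continuous in `p`** on a
parameter box `{|δm| + ‖b‖ < δ}` (dominated convergence: pointwise continuity
`continuousAt_timeIntegrandWith_family`, majorant `(2δ + K₀δ²)|χ₀'(‖y‖)|`). This is the continuity
in `p` of the `O(|p|²)`-part of Li–Mei's `𝓘` needed by the degree step of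
`LiMei.interiorKerrGluing_of_core`. [cite: LiMei2020, proof of Prop. 4.1, p. 25] -/
theorem exists_continuousOn_integral_timeIntegrandWith_family (hr₀ : 0 < r₀) (h2M : r₀ < 2 * M)
    (τ₀ : ℝ) (R₀ : E3 →ₗᵢ[ℝ] E3) {ρ₁ ρ₂ t s : ℝ} (hρ₁ : 1 ≤ ρ₁) (hρt : ρ₁ < t) (hsρ : s < ρ₂)
    {χ₀ : ℝ → ℝ} (hχ : ContDiff ℝ 1 χ₀) (h1 : ∀ r, |r| ≤ t → χ₀ r = 1)
    (h0 : ∀ r, s ≤ |r| → χ₀ r = 0) :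
    ∃ δ : ℝ, 0 < δ ∧ ContinuousOn (fun p : ℝ × E3 ↦ ∫ y, timeIntegrandWith M r₀ χ₀
        (cylH (M + p.1) ‖p.2‖ r₀ τ₀ (spinIsometry p.2) y - cylH M 0 r₀ τ₀ R₀ y)
        (cylK (M + p.1) ‖p.2‖ hr₀ τ₀ (spinIsometry p.2) y - cylK M 0 hr₀ τ₀ R₀ y) y)
      {p : ℝ × E3 | |p.1| + ‖p.2‖ < δ} := by
  obtain ⟨CH, hCH0, hCH⟩ := exists_abs_cylH_sub_sub_firstOrderH_le M hr₀ hρ₁ ρ₂ τ₀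
  obtain ⟨δK, CK, hδK, hCK0, hCK⟩ := exists_abs_cylK_sub_sub_firstOrderK_le hr₀ h2M hρ₁ ρ₂ τ₀
  obtain ⟨δB, hδB, hadm⟩ := exists_eventually_admissible (M := M) hr₀ h2M
  obtain ⟨ha0, h₁0, h₂0⟩ := admissible_zero_spin hr₀ h2M
  refine ⟨min 1 (min δK δB), by positivity, ?_⟩
  set K₀ := Real.sqrt (2 * M / r₀ - 1) *
    (|(M - r₀) / (2 * r₀ ^ 2 * Real.sqrt (2 * M / r₀ - 1))| * (4 * CH) + 4 * CK) with hK₀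
  have hIint : Integrable (fun y : E3 ↦ |deriv χ₀ ‖y‖|) := integrable_abs_deriv_norm hχ h0
  refine continuousOn_of_dominated (bound := fun y ↦ (2 * 1 + K₀ * 1 ^ 2) * |deriv χ₀ ‖y‖|)
    ?_ ?_ (hIint.const_mul _) ?_
  · intro p hp
    have hpB : |p.1| + ‖p.2‖ < δB := lt_of_lt_of_le hp ((min_le_right _ _).trans (min_le_right _ _))
    obtain ⟨ha, h₁, h₂⟩ := (hadm p hpB).self_of_nhds
    exact (measurable_timeIntegrandWith hχ
      ((continuous_cylH hr₀ _ _ τ₀ _).sub (continuous_cylH hr₀ _ _ τ₀ _))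
      ((continuous_cylK ha h₁ h₂ τ₀ _).sub (continuous_cylK ha0 h₁0 h₂0 τ₀ R₀))).aestronglyMeasurable
  · intro p hp
    have hp1 : |p.1| + ‖p.2‖ ≤ 1 := (le_of_lt hp).trans (min_le_left _ _)
    have hpK : |p.1| + ‖p.2‖ ≤ δK := (le_of_lt hp).trans ((min_le_right _ _).trans (min_le_left _ _))
    refine ae_of_all _ fun y ↦ ?_
    rw [Real.norm_eq_abs]
    refine (abs_timeIntegrandWith_family_le hr₀ h2M τ₀ R₀ hρ₁ hρt hsρ h1 h0 hCH hCK hp1 hpK y).trans ?_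
    have hs0 : 0 ≤ |p.1| + ‖p.2‖ := by positivity
    have hK₀0 : 0 ≤ K₀ := by positivity
    refine mul_le_mul_of_nonneg_right ?_ (abs_nonneg _)
    nlinarith [mul_le_mul hp1 hp1 hs0 zero_le_one]
  · refine ae_of_all _ fun y ↦ ?_
    by_cases hd : deriv χ₀ ‖y‖ = 0
    · exact continuousOn_const.congr fun p _ ↦ timeIntegrandWith_eq_zero M r₀ _ _ hd
    · obtain ⟨hty, hys⟩ := norm_mem_Icc_of_deriv_ne_zero h1 h0 hd
      intro p hp
      have hpB : |p.1| + ‖p.2‖ < δB :=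
        lt_of_lt_of_le hp ((min_le_right _ _).trans (min_le_right _ _))
      exact (continuousAt_timeIntegrandWith_family hr₀ τ₀ R₀ hρ₁ χ₀ (lt_of_lt_of_le hρt hty)
        (lt_of_le_of_lt hys hsρ) (hadm p hpB)).continuousWithinAt

/-- **The outer-layer linearised `Ω_ξ`-obstruction of the Kerr family is continuous in `p`**
(`‖ξ‖ ≤ 1`) on a parameter box. [cite: LiMei2020, proof of Prop. 4.1, p. 25] -/
theorem exists_continuousOn_integral_rotIntegrandWith_family (hr₀ : 0 < r₀) (h2M : r₀ < 2 * M)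
    (τ₀ : ℝ) (R₀ : E3 →ₗᵢ[ℝ] E3) {ρ₁ ρ₂ t s : ℝ} (hρ₁ : 1 ≤ ρ₁) (hρt : ρ₁ < t) (hsρ : s < ρ₂)
    {χ₀ : ℝ → ℝ} (hχ : ContDiff ℝ 1 χ₀) (h1 : ∀ r, |r| ≤ t → χ₀ r = 1)
    (h0 : ∀ r, s ≤ |r| → χ₀ r = 0) :
    ∃ δ : ℝ, 0 < δ ∧ ∀ ξ : E3, ‖ξ‖ ≤ 1 →
      ContinuousOn (fun p : ℝ × E3 ↦ ∫ y, rotIntegrandWith M r₀ χ₀ ξ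
        (cylH (M + p.1) ‖p.2‖ r₀ τ₀ (spinIsometry p.2) y - cylH M 0 r₀ τ₀ R₀ y)
        (cylK (M + p.1) ‖p.2‖ hr₀ τ₀ (spinIsometry p.2) y - cylK M 0 hr₀ τ₀ R₀ y) y)
      {p : ℝ × E3 | |p.1| + ‖p.2‖ < δ} := by
  obtain ⟨CH, hCH0, hCH⟩ := exists_abs_cylH_sub_sub_firstOrderH_le M hr₀ hρ₁ ρ₂ τ₀
  obtain ⟨δK, CK, hδK, hCK0, hCK⟩ := exists_abs_cylK_sub_sub_firstOrderK_le hr₀ h2M hρ₁ ρ₂ τ₀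
  obtain ⟨δB, hδB, hadm⟩ := exists_eventually_admissible (M := M) hr₀ h2M
  obtain ⟨ha0, h₁0, h₂0⟩ := admissible_zero_spin hr₀ h2M
  refine ⟨min 1 (min δK δB), by positivity, fun ξ hξ ↦ ?_⟩
  have hsA : 0 < Real.sqrt (2 * M / r₀ - 1) := Real.sqrt_pos.2 (lapse_pos hr₀ h2M)
  set K₁ := r₀ * CH + r₀ ^ 2 / Real.sqrt (2 * M / r₀ - 1) * CK with hK₁
  have hIint : Integrable (fun y : E3 ↦ |deriv χ₀ ‖y‖|) := integrable_abs_deriv_norm hχ h0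
  refine continuousOn_of_dominated (bound := fun y ↦ (6 * |M| * 1 + K₁ * 1 ^ 2) * |deriv χ₀ ‖y‖|)
    ?_ ?_ (hIint.const_mul _) ?_
  · intro p hp
    have hpB : |p.1| + ‖p.2‖ < δB := lt_of_lt_of_le hp ((min_le_right _ _).trans (min_le_right _ _))
    obtain ⟨ha, h₁, h₂⟩ := (hadm p hpB).self_of_nhds
    exact (measurable_rotIntegrandWith hχ ξ
      ((continuous_cylH hr₀ _ _ τ₀ _).sub (continuous_cylH hr₀ _ _ τ₀ _))
      ((continuous_cylK ha h₁ h₂ τ₀ _).sub (continuous_cylK ha0 h₁0 h₂0 τ₀ R₀))).aestronglyMeasurable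
  · intro p hp
    have hp1 : |p.1| + ‖p.2‖ ≤ 1 := (le_of_lt hp).trans (min_le_left _ _)
    have hpK : |p.1| + ‖p.2‖ ≤ δK := (le_of_lt hp).trans ((min_le_right _ _).trans (min_le_left _ _))
    refine ae_of_all _ fun y ↦ ?_
    rw [Real.norm_eq_abs]
    refine (abs_rotIntegrandWith_family_le hr₀ h2M τ₀ R₀ hρ₁ hρt hsρ h1 h0 hCH hCK hp1 hpK hξ
      y).trans ?_
    have hs0 : 0 ≤ |p.1| + ‖p.2‖ := by positivity
    have hK₁0 : 0 ≤ K₁ := by positivity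
    refine mul_le_mul_of_nonneg_right ?_ (abs_nonneg _)
    nlinarith [mul_le_mul hp1 hp1 hs0 zero_le_one, abs_nonneg M]
  · refine ae_of_all _ fun y ↦ ?_
    by_cases hd : deriv χ₀ ‖y‖ = 0
    · exact continuousOn_const.congr fun p _ ↦ rotIntegrandWith_eq_zero M r₀ ξ _ _ hd
    · obtain ⟨hty, hys⟩ := norm_mem_Icc_of_deriv_ne_zero h1 h0 hd
      intro p hp
      have hpB : |p.1| + ‖p.2‖ < δB :=
        lt_of_lt_of_le hp ((min_le_right _ _).trans (min_le_right _ _))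
      exact (continuousAt_rotIntegrandWith_family hr₀ τ₀ R₀ hρ₁ χ₀ ξ (lt_of_lt_of_le hρt hty)
        (lt_of_le_of_lt hys hsρ) (hadm p hpB)).continuousWithinAt


end Outer

end LiMei

end Literature.Geometry.Lorentzian

end
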